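import Summits.CriticalPhenomena.PercolationContinuityZ3.Theses.PercTruncatedSusceptibility
import Summits.CriticalPhenomena.PercolationContinuityZ3.Theorems.PercNecklaceBackboneTruncatedSusceptibilityFiniteOfThetaStubSupercriticalRadiusMoment
import Summits.CriticalPhenomena.PercolationContinuityZ3.Theorems.PercNecklaceBackboneTruncatedSusceptibilityFiniteOfThetaStubChiFiniteOfRadiusMoment
import HarnessLib

/-!
# `TruncatedSusceptibilityFiniteSupercrit` (item stmt-CriticalPhenomena-0854): `χᶠ(p) < ∞` for `p > p_c(ℤ³)`

Route `PercTruncatedSusceptibility` of `PercolationContinuityZ3`, support item stmt-CriticalPhenomena-0854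
(the KNOWN half of the crux L = `TruncatedSusceptibilityFiniteOfTheta`, stmt-0852): for every `p > p_c`,
the truncated connectivity of bond percolation on `ℤ³` is summable,
`Σ_x P_p(0 ↔ x, |C(0)| < ∞) < ∞`. In print: Grimmett 1999, Thm (8.21) with (8.51)
(`τᶠ_p(0,x) ≤ A‖x‖³ e^{−σ(p)‖x‖}`, `σ(p) > 0` for `p > p_c`; Chayes–Chayes–Newman 1987).

Proof (two landed stubs of the lead's skeleton `Cruxes/TruncatedSusceptibilityFiniteOfTheta/Lines/birth.lean`):
* `stub_supercriticalRadiusMoment` — for `p > p_c` the finite-cluster one-arm probabilities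
  `P_p(0 ↔ ∂B(n) in B(n), |C(0)| < ∞)` have a finite second shell moment (in tree from the discharged
  Duminil-Copin–Kozma–Tassion 2020 Theorem 2, `DuminilcopinKozmaTassion2020_thm2_supercritical_holds`,
  and `θ(1) = 1`);
* `stub_chiFiniteOfRadiusMoment` — volume from radius at every `p` (first exit + shell counting).
-/

namespace Summit.CriticalPhenomena.PercolationContinuityZ3.Theorems.TruncatedSusceptibilityFiniteOfTheta

/-- **Item stmt-CriticalPhenomena-0854** (`PercTruncatedSusceptibility.TruncatedSusceptibilityFiniteSupercrit`):
for `p > p_c(ℤ³)`, `Σ_x P_p(0 ↔ x, |C(0)| < ∞) < ∞` (Grimmett 1999 Thm (8.21) + (8.51), here through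
DKT 2020 Thm 2 and the radius-to-volume counting lemma). -/
theorem truncatedSusceptibilityFiniteSupercrit_proof :
    Summit.CriticalPhenomena.PercolationContinuityZ3.Theses.PercTruncatedSusceptibility.TruncatedSusceptibilityFiniteSupercrit :=
  fun p hp => stub_chiFiniteOfRadiusMoment p (stub_supercriticalRadiusMoment p hp)

end Summit.CriticalPhenomena.PercolationContinuityZ3.Theorems.TruncatedSusceptibilityFiniteOfTheta
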